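import Mathlib
import Literature.NumberTheory.LFunctions.Zhang2022.Section13ZeroSumQuadratic
import Literature.NumberTheory.LFunctions.Zhang2022.Section13MeanSquaresShort
import HarnessLib

/-!
# Zhang (2022) §13 p. 75, (13.11): the zero-side quadratic sums of the short polynomial factors
# `B`, `N(·+β)B`, `D_{T³}(·+β)B`, `N(·+β)`, `N(·+β)N(·+β′)` — Z-POLY, the G2 instances

Topic `Literature/NumberTheory/LFunctions/Zhang2022` (Landau–Siegel audit tree; verdict-neutral).
Y. Zhang, *Discrete mean estimates and the Landau–Siegel zero*, arXiv:2211.02515v1 (2022)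
[Zhang2022LandauSiegel], §13 p. 75 (tex L3806–L3817): "Combining (2.34), Cauchy's inequality,
Proposition 7.1, Lemma 5.9, 6.1 and 3.3, we can verify that `𝔈 = o(𝔓)`" — the verification is not in
print (GAP row G-L3t6-3; lane ZHANG-L WP14, leaf `Skeleton.Eq1311Rel`, owner's NEW ROWS "Z-POLY").
An unrefereed manuscript under adjudication; nothing here asserts its Theorems 1–2 or (13.11).

After Cauchy's inequality on the positive weights `w(ρ,ψ) = |L(ρ+β₁,ψ)/L′(ρ,ψ)|·|ω(ρ)|`, every term of
`𝔈` is controlled by quadratic zero-sums `Q(F) = Σ_{ψ∈Ψ₁}Σ_{ρ∈𝔷(ψ)} w(ρ,ψ)|F(ρ,ψ)|²`. For the SHORT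
polynomial factors (merged length `≤ P`) this file instantiates the generic zero-side bound
`zeroSum_dirPoly_sq_le_of_prop22` ((2.34)-conversion + Lemma 5.9 + Lemma 3.3 (i) by orthogonality —
loss-free in `𝔓`) at the `ψ`-free coefficient sequences of `Section13MeanSquaresParams`/`Tools`
(`B` via (15.1)–(15.2) with `b(n) = 0` for `n ≥ PT⁻⁷`; `N(s+β,ψ)` and the `E₁`-polynomial with the
purely imaginary shift in the coefficient; products via `dirPoly_mul_dirPoly_eq`) and their logarithmic
coefficient means (`sum_norm_sq_div_le_of_dom_tau_two`, `sum_norm_seqConv_short_bcoef_sq_div_le`,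
`sum_norm_seqConv_short_short_sq_div_le`, `sum_norm_sq_div_le_one_add_log`):

* `zeroSum_Bpoly_sq_le_of_prop22` — `Q(B) ≤ C·𝔓·𝓛⁴⁵`;
* `zeroSum_Nchar_Bpoly_sq_le_of_prop22` — `Q(N(·+β)B) ≤ C·𝔓·𝓛⁵⁵` (`Re β = 0`);
* `zeroSum_E1poly_Bpoly_sq_le_of_prop22` — `Q(D_{T³}(·+β)B) ≤ C·𝔓·𝓛⁵⁵` (`Re β = 0`, e.g. `β = β_j + iv`);
* `zeroSum_Nchar_sq_le_of_prop22` — `Q(N(·+β)) ≤ C·𝔓·𝓛¹¹`;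
* `zeroSum_Nchar_Nchar_sq_le_of_prop22` — `Q(N(·+β)N(·+β′)) ≤ C·𝔓·𝓛¹⁷`;

all under `0 ≤ c′`, `Prop22 c′` (the clearance of Proposition 2.2 used by the conversion), constants
independent of `β`. The negligible term `K𝔓(c_max P)²e^{−𝓛¹⁰/8}` of the generic bound is absorbed
(`c_max` polynomial in `P`). Theorems only; no new definition.

## References

* Y. Zhang, arXiv:2211.02515v1 (2022), §13 p. 75; §3 Lemma 3.3 (i); §6 Lemma 6.1; §15 (15.1)–(15.2);
  §2 (2.34). [cite: Zhang2022LandauSiegel, §13 (13.11) p.75]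
-/

noncomputable section

open Complex Real Finset Filter

namespace Literature.NumberTheory.LFunctions.Zhang2022.Typed.Section13

open Skeleton MeanSquareMajorant Section7Eq75

variable {D : ℕ}

/-! ## Plumbing: the diagonal weights, crude coefficient sups, absorption of the negligible term -/

/-- The two diagonal weights of the zero-side bound are each `≤ e^{8π}/n` on `n ≤ ⌊P⌋` (`𝓛 ≥ 1`):
`Σ_{n≤⌊P⌋} |c(n)|²(n^{−(1+2α)} + n^{−(1−2α)}) ≤ 2e^{8π}·Σ_{n≤⌊P⌋} |c(n)|²/n`.
[cite: Zhang2022LandauSiegel, §13 p.75; §2 (2.10)] -/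
theorem diagWeights_le (hL : 1 ≤ ell D) (c : ℕ → ℂ) :
    ∑ n ∈ Icc 1 ⌊bigP D⌋₊, ‖c n‖ ^ 2 * ((n : ℝ) ^ (-(1 + 2 * alpha D)) + (n : ℝ) ^ (-(1 - 2 * alpha D))) ≤
      2 * Real.exp (8 * π) * ∑ n ∈ Icc 1 ⌊bigP D⌋₊, ‖c n‖ ^ 2 / n := by
  have hα : 0 ≤ alpha D := by rw [alpha, bigP, Real.log_exp]; positivity
  have hσ₁ : |(1 / 2 + alpha D) - 1 / 2| ≤ 2 * alpha D := by
    rw [show (1 / 2 + alpha D) - 1 / 2 = alpha D by ring, abs_of_nonneg hα]; linarith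
  have hσ₂ : |(1 / 2 - alpha D) - 1 / 2| ≤ 2 * alpha D := by
    rw [show (1 / 2 - alpha D) - 1 / 2 = -alpha D by ring, abs_neg, abs_of_nonneg hα]; linarith
  have h1 := sum_norm_sq_rpow_le hL hσ₁ (floor_bigP_le_sq D).1 c
  have h2 := sum_norm_sq_rpow_le hL hσ₂ (floor_bigP_le_sq D).1 c
  have e1 : ∀ n : ℕ, (n : ℝ) ^ (-(1 + 2 * alpha D)) = (n : ℝ) ^ (-2 * (1 / 2 + alpha D)) := fun n => by
    congr 1; ring
  have e2 : ∀ n : ℕ, (n : ℝ) ^ (-(1 - 2 * alpha D)) = (n : ℝ) ^ (-2 * (1 / 2 - alpha D)) := fun n => by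
    congr 1; ring
  simp_rw [mul_add, Finset.sum_add_distrib, e1, e2]
  linarith

/-- **Crude sup of a convolution of truncated sequences**: if `|u| ≤ U`, `u(n) = 0` for `n ≥ M`, `|v(n)| ≤ V`
for `n < N` and `v(n) = 0` for `n ≥ N`, then `|(u ⋆ v)(k)| ≤ M·N·U·V` for every `k` (the `c_max` of the
negligible term). [cite: Zhang2022LandauSiegel, §13 p.75] -/
theorem norm_seqConv_trunc_le {u v : ℕ → ℂ} {U V : ℝ} (hU : 0 ≤ U) {M N : ℕ}
    (hu : ∀ n, ‖u n‖ ≤ U) (hu0 : ∀ n, M ≤ n → u n = 0) (hv : ∀ n, n < N → ‖v n‖ ≤ V)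
    (hv0 : ∀ n, N ≤ n → v n = 0) (k : ℕ) :
    ‖seqConv u v k‖ ≤ (M : ℝ) * N * U * V := by
  classical
  unfold seqConv
  set S := Ico 0 M ×ˢ Ico 0 N with hS
  have hsplit : ∀ x ∈ k.divisorsAntidiagonal, x ∉ S → ‖u x.1 * v x.2‖ = 0 := by
    intro x _ hx
    rw [hS, Finset.mem_product, Finset.mem_Ico, Finset.mem_Ico, not_and_or] at hx
    rw [norm_mul]
    rcases hx with h | h
    · rw [hu0 x.1 (by omega), norm_zero, zero_mul]
    · rw [hv0 x.2 (by omega), norm_zero, mul_zero]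
  calc ‖∑ x ∈ k.divisorsAntidiagonal, u x.1 * v x.2‖
      ≤ ∑ x ∈ k.divisorsAntidiagonal, ‖u x.1 * v x.2‖ := norm_sum_le _ _
    _ = ∑ x ∈ k.divisorsAntidiagonal.filter (fun x => x ∈ S), ‖u x.1 * v x.2‖ := by
        rw [Finset.sum_filter_of_ne]
        intro x hx hne
        by_contra h
        exact hne (hsplit x hx h)
    _ ≤ ∑ x ∈ S, ‖u x.1 * v x.2‖ :=
        Finset.sum_le_sum_of_subset_of_nonneg (fun x hx => (Finset.mem_filter.mp hx).2)
          fun x _ _ => norm_nonneg _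
    _ ≤ ∑ x ∈ S, U * V := by
        refine Finset.sum_le_sum fun x hx => ?_
        rw [hS, Finset.mem_product, Finset.mem_Ico, Finset.mem_Ico] at hx
        rw [norm_mul]
        exact mul_le_mul (hu _) (hv _ hx.2.2) (norm_nonneg _) hU
    _ = (M : ℝ) * N * U * V := by
        rw [Finset.sum_const, nsmul_eq_mul, hS, Finset.card_product, Nat.card_Ico, Nat.card_Ico,
          Nat.sub_zero, Nat.sub_zero]
        push_cast; ring

/-- **Absorption of the negligible term**: for every `K, A ≥ 0` and `m`, for all large `D`,
`K·(A·(P+1)^m·P)²·e^{−𝓛¹⁰/8} ≤ 1` (`P = e^{𝓛⁹}`). [cite: Zhang2022LandauSiegel, §13 p.75; §2 (2.6)] -/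
theorem tail_absorb (K A : ℝ) (m : ℕ) : ∃ D₀ : ℕ, ∀ D : ℕ, D₀ ≤ D →
    K * (A * (bigP D + 1) ^ m * bigP D) ^ 2 * Real.exp (-(ell D ^ 10 / 8)) ≤ 1 := by
  obtain ⟨D₀, hD₀⟩ := Filter.eventually_atTop.mp
    (tendsto_ell_atTop.eventually (eventually_ge_atTop (max (16 * (m : ℝ) + 24) (|K| * A ^ 2 * 4 ^ m + 1))))
  refine ⟨D₀, fun D hD => ?_⟩
  have hℓ := hD₀ D hD
  have hℓ1 : 16 * (m : ℝ) + 24 ≤ ell D := le_trans (le_max_left _ _) hℓ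
  have hℓ2 : |K| * A ^ 2 * 4 ^ m + 1 ≤ ell D := le_trans (le_max_right _ _) hℓ
  have hm0 : (0 : ℝ) ≤ m := Nat.cast_nonneg m
  have hL1 : 1 ≤ ell D := by linarith
  have hP : 0 < bigP D := Real.exp_pos _
  have hP1 : 1 ≤ bigP D := by rw [bigP]; exact Real.one_le_exp (by positivity)
  -- `(A (P+1)^m P)² ≤ A² 4^m P^{2m+2} = A² 4^m exp((2m+2)𝓛⁹)`
  have h1 : (A * (bigP D + 1) ^ m * bigP D) ^ 2 ≤ A ^ 2 * 4 ^ m * Real.exp ((2 * m + 2) * ell D ^ 9) := by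
    have hle : (bigP D + 1) ^ m ≤ (2 * bigP D) ^ m :=
      pow_le_pow_left₀ (by positivity) (by linarith) m
    have e : Real.exp ((2 * m + 2) * ell D ^ 9) = (bigP D ^ m * bigP D) ^ 2 := by
      rw [bigP, ← Real.exp_nat_mul, ← Real.exp_add, ← Real.exp_nat_mul]; ring_nf
    rw [e]
    calc (A * (bigP D + 1) ^ m * bigP D) ^ 2 = A ^ 2 * ((bigP D + 1) ^ m) ^ 2 * bigP D ^ 2 := by ring
      _ ≤ A ^ 2 * ((2 * bigP D) ^ m) ^ 2 * bigP D ^ 2 := by gcongr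
      _ = A ^ 2 * 4 ^ m * (bigP D ^ m * bigP D) ^ 2 := by
          rw [mul_pow, show (4 : ℝ) = 2 ^ 2 by norm_num, ← pow_mul]
          ring
  -- the exponent: `(2m+2)𝓛⁹ − 𝓛¹⁰/8 ≤ −𝓛`
  have h2 : (2 * m + 2) * ell D ^ 9 - ell D ^ 10 / 8 ≤ -ell D := by
    have h9 : ell D ≤ ell D ^ 9 := le_self_pow₀ hL1 (by norm_num)
    have e : ell D ^ 10 / 8 = (ell D / 8) * ell D ^ 9 := by ring
    rw [e]
    nlinarith [pow_nonneg (show 0 ≤ ell D by linarith) 9]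
  have h3 : |K| * A ^ 2 * 4 ^ m * Real.exp (-ell D) ≤ 1 := by
    have hx : |K| * A ^ 2 * 4 ^ m ≤ Real.exp (ell D) := by
      calc |K| * A ^ 2 * 4 ^ m ≤ ell D := by linarith
        _ ≤ ell D + 1 := by linarith
        _ ≤ Real.exp (ell D) := Real.add_one_le_exp _
    rw [Real.exp_neg]
    have hE : 0 < Real.exp (ell D) := Real.exp_pos _
    rw [mul_inv_le_iff₀ hE]; linarith
  calc K * (A * (bigP D + 1) ^ m * bigP D) ^ 2 * Real.exp (-(ell D ^ 10 / 8))
      ≤ |K| * (A * (bigP D + 1) ^ m * bigP D) ^ 2 * Real.exp (-(ell D ^ 10 / 8)) := by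
        gcongr; exact le_abs_self K
    _ ≤ |K| * (A ^ 2 * 4 ^ m * Real.exp ((2 * m + 2) * ell D ^ 9)) * Real.exp (-(ell D ^ 10 / 8)) := by
        gcongr
    _ = |K| * A ^ 2 * 4 ^ m * Real.exp ((2 * m + 2) * ell D ^ 9 - ell D ^ 10 / 8) := by
        rw [sub_eq_add_neg, Real.exp_add]; ring
    _ ≤ |K| * A ^ 2 * 4 ^ m * Real.exp (-ell D) := by gcongr
    _ ≤ 1 := h3

/-- **The core: the generic zero-side bound with the diagonal in logarithmic form and the negligible term
absorbed.** For `0 ≤ c′`, `Prop22 c′`, `A ≥ 0`, `m`: there are `C ≥ 0`, `D₀` with, for `D ≥ D₀`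
(`𝓛 ≥ 4`), `χ` real primitive, every `c` with `|c(n)| ≤ A(P+1)^m`:
`Q(Σ_{n≤⌊P⌋} c(n)ψ(n)n^{−ρ}) ≤ C·𝔓·𝓛⁹·Σ_{n≤⌊P⌋}|c(n)|²/n + 𝔓`.
[cite: Zhang2022LandauSiegel, §13 p.75, tex L3806–L3817; §3 Lemma 3.3 (i)] -/
theorem zeroSum_core_of_prop22 {c' : ℝ} (hc' : 0 ≤ c') (h22 : Prop22 c') (A : ℝ) (hA : 0 ≤ A) (m : ℕ) :
    ∃ C : ℝ, 0 ≤ C ∧ ∃ D₀ : ℕ, ∀ (D : ℕ) [NeZero D] (χ : DirichletCharacter ℂ D), D₀ ≤ D →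
      χ.IsQuadratic → χ.IsPrimitive → 4 ≤ ell D ∧ ∀ c : ℕ → ℂ, (∀ n, ‖c n‖ ≤ A * (bigP D + 1) ^ m) →
        (∑ x ∈ finsetOf (PsiOne χ), ∑ ρ ∈ finsetOf (zeroSet D x),
            ‖x.ψ.LFunction (ρ + beta1 c' D) / deriv x.ψ.LFunction ρ‖ *
              ‖∑ n ∈ Icc 1 ⌊bigP D⌋₊, c n * x.ψ (n : ZMod x.p) * (n : ℂ) ^ (-ρ)‖ ^ 2 * ‖omegaW D ρ‖) ≤
          C * frakP D * ell D ^ 9 * (∑ n ∈ Icc 1 ⌊bigP D⌋₊, ‖c n‖ ^ 2 / n) + frakP D := by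
  obtain ⟨K, hK, C, hC, D₁, hG⟩ := zeroSum_dirPoly_sq_le_of_prop22 hc' h22
  obtain ⟨D₂, hD₂⟩ := tail_absorb K A m
  obtain ⟨D₃, hD₃⟩ := Filter.eventually_atTop.mp (tendsto_ell_atTop.eventually (eventually_ge_atTop 4))
  refine ⟨C * (2 * Real.exp (8 * π)), by positivity, max D₁ (max D₂ D₃), fun D _ χ hD hq hp => ?_⟩
  have hD₁ : D₁ ≤ D := (le_max_left _ _).trans hD
  have hD₂' : D₂ ≤ D := (le_max_left _ _).trans ((le_max_right _ _).trans hD)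
  have hL : 4 ≤ ell D := hD₃ D ((le_max_right _ _).trans ((le_max_right _ _).trans hD))
  have hL1 : 1 ≤ ell D := by linarith
  refine ⟨hL, fun c hc => ?_⟩
  have hP : 0 ≤ frakP D := by
    rw [frakP_eq_sum_primeWindow]; exact Finset.sum_nonneg fun p _ => Nat.cast_nonneg p
  have hCmax : 0 ≤ A * (bigP D + 1) ^ m := by
    have hP0 : 0 < bigP D := Real.exp_pos _
    positivity
  have h1 := hG D χ hD₁ hq hp c _ hCmax hc
  have h2 := diagWeights_le hL1 c
  have h3 := hD₂ D hD₂'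
  have hℓ9 : 0 ≤ ell D ^ 9 := by positivity
  calc _ ≤ C * ell D ^ 9 * frakP D *
          (∑ n ∈ Icc 1 ⌊bigP D⌋₊, ‖c n‖ ^ 2 * ((n : ℝ) ^ (-(1 + 2 * alpha D)) + (n : ℝ) ^ (-(1 - 2 * alpha D)))) +
          K * frakP D * (A * (bigP D + 1) ^ m * bigP D) ^ 2 * Real.exp (-(ell D ^ 10 / 8)) := h1
    _ ≤ C * ell D ^ 9 * frakP D * (2 * Real.exp (8 * π) * ∑ n ∈ Icc 1 ⌊bigP D⌋₊, ‖c n‖ ^ 2 / n) +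
          frakP D * (K * (A * (bigP D + 1) ^ m * bigP D) ^ 2 * Real.exp (-(ell D ^ 10 / 8))) := by
        refine add_le_add (mul_le_mul_of_nonneg_left h2 (by positivity)) (le_of_eq (by ring))
    _ ≤ C * ell D ^ 9 * frakP D * (2 * Real.exp (8 * π) * ∑ n ∈ Icc 1 ⌊bigP D⌋₊, ‖c n‖ ^ 2 / n) +
          frakP D * 1 := by gcongr
    _ = _ := by ring

/-! ## The five instances -/

/-- The truncated coefficient sequence of `B`: bounded by `βc·(⌈PT⁻⁷⌉)²` (crude; `τ₂(n) ≤ n²` is not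
needed: `|b(n)χ(n)| ≤ βc τ₂(n) ≤ βc·#divisors ≤ βc·n`). [cite: Zhang2022LandauSiegel, §15 (15.2) p.79] -/
theorem norm_bcoef_chi_trunc_le [NeZero D] (χ : DirichletCharacter ℂ D) (hD : 2 ≤ Real.log D) (N n : ℕ)
    (hn : n < N) : ‖bcoef D n * χ (n : ZMod D)‖ ≤ (1 + ‖iota2‖) * (‖iota3‖ + ‖iota4‖) * N := by
  rcases Nat.eq_zero_or_pos n with rfl | hn0
  · rw [bcoef, Nat.divisorsAntidiagonal_zero, Finset.sum_empty, zero_mul, norm_zero]; positivity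
  · have h := dom_bcoef_chi χ hD n hn0.ne'
    refine h.trans (mul_le_mul_of_nonneg_left ?_ (by positivity))
    rw [tau_two_apply]
    calc (n.divisors.card : ℝ) ≤ n := by exact_mod_cast Nat.card_divisors_le_self n
      _ ≤ N := by exact_mod_cast hn.le

/-- **Z-POLY (`B`): `Q(B) ≤ C·𝔓·𝓛⁴⁵`** for `0 ≤ c′`, `Prop22 c′`
(coefficients `b(n)χ(n) ≪ τ₂`, length `PT⁻⁷`; `Σ τ₂²/n ≪ (log P)⁴ = 𝓛³⁶`, `× 𝓛⁹` from Lemma 5.9).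
[cite: Zhang2022LandauSiegel, §13 p.75; §15 (15.1)–(15.2); §3 Lemma 3.3 (i)] -/
theorem zeroSum_Bpoly_sq_le_of_prop22 {c' : ℝ} (hc' : 0 ≤ c') (h22 : Prop22 c') :
    ∃ C : ℝ, 0 ≤ C ∧ ForAllLarge fun D _ χ =>
      ∑ x ∈ finsetOf (PsiOne χ), ∑ ρ ∈ finsetOf (zeroSet D x),
          ‖x.ψ.LFunction (ρ + beta1 c' D) / deriv x.ψ.LFunction ρ‖ * ‖Bpoly χ x ρ‖ ^ 2 *
            ‖omegaW D ρ‖ ≤ C * frakP D * ell D ^ 45 := by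
  set βc : ℝ := (1 + ‖iota2‖) * (‖iota3‖ + ‖iota4‖) with hβc
  obtain ⟨C, hC, D₀, hcore⟩ := zeroSum_core_of_prop22 hc' h22 βc (by positivity) 1
  have hmc0 : 0 < majorantConst 4 4 := majorantConst_pos _ _
  refine ⟨C * (βc ^ 2 * majorantConst 4 4) + 1, by positivity, D₀, fun D _ χ hD hq hp => ?_⟩
  obtain ⟨hL, hmain⟩ := hcore D χ hD hq hp
  have hL1 : 1 ≤ ell D := by linarith
  have hD2 : 2 ≤ Real.log D := by have h := hL; rw [ell] at h; linarith
  obtain ⟨-, ⟨-, -, hlogP⟩, -, ⟨-, -, hlenB⟩⟩ := lengths_of_four_le_ell hL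
  obtain ⟨-, -, -, hP2⟩ := sizes_of_four_le_ell hL
  set NB := ⌈bigP D / bigT D ^ 7⌉₊ with hNB
  set v' : ℕ → ℂ := fun n => if n < NB then bcoef D n * χ (n : ZMod D) else 0 with hv'
  have hP : 0 ≤ frakP D := by
    rw [frakP_eq_sum_primeWindow]; exact Finset.sum_nonneg fun p _ => Nat.cast_nonneg p
  have hP0 : 0 < bigP D := Real.exp_pos _
  -- `B` in the G2 frame
  have hpoly : ∀ (x : Chr D) (ρ : ℂ), Bpoly χ x ρ =
      ∑ n ∈ Icc 1 ⌊bigP D⌋₊, v' n * x.ψ (n : ZMod x.p) * (n : ℂ) ^ (-ρ) := by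
    intro x ρ
    rw [Bpoly_eq_dirPoly χ hL x ρ]
    exact sum_Ico_eq_sum_Icc_trunc hlenB _ _ ρ
  -- the sup: `NB ≤ P + 1`
  have hNBle : (NB : ℝ) ≤ bigP D + 1 := by
    have h1 : ((NB - 1 : ℕ) : ℝ) ≤ ⌊bigP D⌋₊ := by exact_mod_cast hlenB
    have h2 : (⌊bigP D⌋₊ : ℝ) ≤ bigP D := Nat.floor_le hP0.le
    have h3 : (NB : ℝ) ≤ ((NB - 1 : ℕ) : ℝ) + 1 := by
      rcases Nat.eq_zero_or_pos NB with h | h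
      · rw [h]; simp
      · rw [Nat.cast_sub h]; simp
    linarith
  have hsup : ∀ n, ‖v' n‖ ≤ βc * (bigP D + 1) ^ 1 := by
    intro n
    simp only [hv']
    split_ifs with h
    · rw [pow_one]
      exact (norm_bcoef_chi_trunc_le χ hD2 NB n h).trans (mul_le_mul_of_nonneg_left hNBle (by positivity))
    · rw [norm_zero]; positivity
  have h1 := hmain v' hsup
  -- the diagonal
  have hv : Dom v' βc (tau 2) :=
    dom_trunc_of_dom (dom_bcoef_chi χ hD2) (by positivity) (tau_nonneg 2) NB
  have hcoef := sum_norm_sq_div_le_of_dom_tau_two hv hP2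
  have hlog4 : Real.log (⌊bigP D⌋₊ : ℝ) ^ 4 ≤ ell D ^ 36 := by
    have h0 : 0 ≤ Real.log (⌊bigP D⌋₊ : ℝ) := Real.log_nonneg (by exact_mod_cast (by omega : 1 ≤ ⌊bigP D⌋₊))
    calc Real.log (⌊bigP D⌋₊ : ℝ) ^ 4 ≤ (ell D ^ 9) ^ 4 := pow_le_pow_left₀ h0 hlogP 4
      _ = ell D ^ 36 := by ring
  have hℓ45 : 1 ≤ ell D ^ 45 := one_le_pow₀ hL1
  have hmc := (majorantConst_pos 4 4).le
  calc _ = ∑ x ∈ finsetOf (PsiOne χ), ∑ ρ ∈ finsetOf (zeroSet D x),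
          ‖x.ψ.LFunction (ρ + beta1 c' D) / deriv x.ψ.LFunction ρ‖ *
            ‖∑ n ∈ Icc 1 ⌊bigP D⌋₊, v' n * x.ψ (n : ZMod x.p) * (n : ℂ) ^ (-ρ)‖ ^ 2 * ‖omegaW D ρ‖ := by
        refine Finset.sum_congr rfl fun x _ => Finset.sum_congr rfl fun ρ _ => ?_
        rw [hpoly x ρ]
    _ ≤ C * frakP D * ell D ^ 9 * (∑ n ∈ Icc 1 ⌊bigP D⌋₊, ‖v' n‖ ^ 2 / n) + frakP D := h1
    _ ≤ C * frakP D * ell D ^ 9 * (βc ^ 2 * (majorantConst 4 4 * ell D ^ 36)) + frakP D * ell D ^ 45 := by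
        refine add_le_add (mul_le_mul_of_nonneg_left (hcoef.trans ?_) (by positivity)) ?_
        · exact mul_le_mul_of_nonneg_left (mul_le_mul_of_nonneg_left hlog4 hmc) (sq_nonneg _)
        · calc frakP D = frakP D * 1 := (mul_one _).symm
            _ ≤ frakP D * ell D ^ 45 := mul_le_mul_of_nonneg_left hℓ45 hP
    _ = (C * (βc ^ 2 * majorantConst 4 4) + 1) * frakP D * ell D ^ 45 := by ring

/-- **The core of the two `(short)·B` rows**: for `𝓛 ≥ 4` (with the core's constant `C`), `Re β = 0`,
`|g| ≤ 1`, a length `M` with `(M−1)(⌈PT⁻⁷⌉−1) ≤ ⌊P⌋`, `2 ≤ M`, `M − 1 ≤ ⌊P⌋`, `log M ≤ c𝓛²`: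
`Q((Σ_{n<M} g(n)n^{−β}ψ(n)n^{−ρ})·B) ≤ (C·βc²·mC₉₆·c⁵ + 1)·𝔓·𝓛⁵⁵`.
[cite: Zhang2022LandauSiegel, §13 p.75; §15 (15.2); §6 Lemma 6.1] -/
theorem zeroSum_short_Bpoly_le [NeZero D] (χ : DirichletCharacter ℂ D) {c' C : ℝ} (hC : 0 ≤ C)
    (hL : 4 ≤ ell D)
    (hmain : ∀ c : ℕ → ℂ, (∀ n, ‖c n‖ ≤ ((1 + ‖iota2‖) * (‖iota3‖ + ‖iota4‖)) * (bigP D + 1) ^ 3) →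
      (∑ x ∈ finsetOf (PsiOne χ), ∑ ρ ∈ finsetOf (zeroSet D x),
          ‖x.ψ.LFunction (ρ + beta1 c' D) / deriv x.ψ.LFunction ρ‖ *
            ‖∑ n ∈ Icc 1 ⌊bigP D⌋₊, c n * x.ψ (n : ZMod x.p) * (n : ℂ) ^ (-ρ)‖ ^ 2 * ‖omegaW D ρ‖) ≤
        C * frakP D * ell D ^ 9 * (∑ n ∈ Icc 1 ⌊bigP D⌋₊, ‖c n‖ ^ 2 / n) + frakP D)
    {β : ℂ} (hβ : β.re = 0) {g : ℕ → ℂ} (hg : ∀ n, ‖g n‖ ≤ 1) {M : ℕ} (hM2 : 2 ≤ M)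
    (hMlen : (M - 1) * (⌈bigP D / bigT D ^ 7⌉₊ - 1) ≤ ⌊bigP D⌋₊) (hM1 : M - 1 ≤ ⌊bigP D⌋₊)
    {c : ℝ} (hlogM : Real.log M ≤ c * ell D ^ 2) :
    (∑ x ∈ finsetOf (PsiOne χ), ∑ ρ ∈ finsetOf (zeroSet D x),
        ‖x.ψ.LFunction (ρ + beta1 c' D) / deriv x.ψ.LFunction ρ‖ *
          ‖(∑ n ∈ Ico 1 M, (g n * (n : ℂ) ^ (-β)) * x.ψ (n : ZMod x.p) * (n : ℂ) ^ (-ρ)) *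
            Bpoly χ x ρ‖ ^ 2 * ‖omegaW D ρ‖) ≤
      (C * (((1 + ‖iota2‖) * (‖iota3‖ + ‖iota4‖)) ^ 2 * majorantConst 9 6 * c ^ 5) + 1) *
        frakP D * ell D ^ 55 := by
  have hL1 : 1 ≤ ell D := by linarith
  have hℓ : 0 < ell D := by linarith
  have hD2 : 2 ≤ Real.log D := by have h := hL; rw [ell] at h; linarith
  obtain ⟨-, ⟨-, -, hlogP⟩, -, ⟨-, -, hlenB⟩⟩ := lengths_of_four_le_ell hL
  obtain ⟨-, -, -, hP2⟩ := sizes_of_four_le_ell hL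
  set NB := ⌈bigP D / bigT D ^ 7⌉₊ with hNB
  set βc : ℝ := (1 + ‖iota2‖) * (‖iota3‖ + ‖iota4‖) with hβc
  have hP : 0 ≤ frakP D := by
    rw [frakP_eq_sum_primeWindow]; exact Finset.sum_nonneg fun p _ => Nat.cast_nonneg p
  have hP0 : 0 < bigP D := Real.exp_pos _
  set u' : ℕ → ℂ := fun n => if n < M then g n * (n : ℂ) ^ (-β) else 0 with hu'
  set v' : ℕ → ℂ := fun n => if n < NB then bcoef D n * χ (n : ZMod D) else 0 with hv'
  have hprod : ∀ (x : Chr D) (ρ : ℂ),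
      (∑ n ∈ Ico 1 M, (g n * (n : ℂ) ^ (-β)) * x.ψ (n : ZMod x.p) * (n : ℂ) ^ (-ρ)) * Bpoly χ x ρ =
        ∑ k ∈ Icc 1 ⌊bigP D⌋₊, seqConv u' v' k * x.ψ (k : ZMod x.p) * (k : ℂ) ^ (-ρ) := by
    intro x ρ
    rw [Bpoly_eq_dirPoly χ hL x ρ]
    exact dirPoly_mul_dirPoly_eq M NB ⌊bigP D⌋₊ hMlen _ _ _ (psi_natCast_mul x).1 ρ
  -- sizes `M, NB ≤ P + 1`
  have hfl : (⌊bigP D⌋₊ : ℝ) ≤ bigP D := Nat.floor_le hP0.le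
  have hle_of : ∀ {L : ℕ}, L - 1 ≤ ⌊bigP D⌋₊ → (L : ℝ) ≤ bigP D + 1 := by
    intro L hL'
    have h1 : ((L - 1 : ℕ) : ℝ) ≤ ⌊bigP D⌋₊ := by exact_mod_cast hL'
    have h3 : (L : ℝ) ≤ ((L - 1 : ℕ) : ℝ) + 1 := by
      rcases Nat.eq_zero_or_pos L with h | h
      · rw [h]; simp
      · rw [Nat.cast_sub h]; simp
    linarith
  have hMle : (M : ℝ) ≤ bigP D + 1 := hle_of hM1
  have hNBle : (NB : ℝ) ≤ bigP D + 1 := hle_of hlenB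
  -- the sup of the product coefficients: `M·NB·1·(βc NB) ≤ βc (P+1)^3`
  have hu1 : ∀ n, ‖u' n‖ ≤ 1 := by
    intro n
    simp only [hu']
    split_ifs with h
    · rcases Nat.eq_zero_or_pos n with rfl | hn
      · have : (0 : ℂ) ^ (-β) = 0 ∨ (0 : ℂ) ^ (-β) = 1 := by
          by_cases hb : -β = 0
          · right; rw [hb, Complex.cpow_zero]
          · left; exact Complex.zero_cpow hb
        rcases this with h0 | h0 <;> rw [Nat.cast_zero, h0]
        · simp
        · rw [mul_one]; exact hg 0
      · rw [norm_mul, norm_natCast_cpow_neg_of_re_zero hn.ne' hβ, mul_one]; exact hg n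
    · simp
  have hsup : ∀ k, ‖seqConv u' v' k‖ ≤ βc * (bigP D + 1) ^ 3 := by
    intro k
    have h := norm_seqConv_trunc_le (u := u') (v := v') zero_le_one
      (M := M) (N := NB) hu1 (fun n hn => by simp only [hu']; rw [if_neg (not_lt.mpr hn)])
      (fun n hn => by
        simp only [hv']; rw [if_pos hn]; exact norm_bcoef_chi_trunc_le χ hD2 NB n hn)
      (fun n hn => by simp only [hv']; rw [if_neg (not_lt.mpr hn)]) k
    refine h.trans ?_
    have hNB0 : (0 : ℝ) ≤ NB := Nat.cast_nonneg _
    calc (M : ℝ) * NB * 1 * (βc * NB) = βc * (M * (NB * NB)) := by ring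
      _ ≤ βc * ((bigP D + 1) * ((bigP D + 1) * (bigP D + 1))) := by
          gcongr
      _ = βc * (bigP D + 1) ^ 3 := by ring
  have h1 := hmain (seqConv u' v') hsup
  -- the diagonal
  have hu : Dom u' 1 (smoothIndLE M) := dom_trunc_unimodular hg hβ M
  have hv : Dom v' βc (tau 2) :=
    dom_trunc_of_dom (dom_bcoef_chi χ hD2) (by positivity) (tau_nonneg 2) NB
  have hcoef := sum_norm_seqConv_short_bcoef_sq_div_le hu hv hM2 hP2
  rw [one_mul] at hcoef
  have hc0 : 0 ≤ c := by
    have : 0 ≤ Real.log M := Real.log_nonneg (by exact_mod_cast (by omega : 1 ≤ M))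
    nlinarith [pow_pos hℓ 2]
  have hlog4 : Real.log (⌊bigP D⌋₊ : ℝ) ^ 4 ≤ ell D ^ 36 := by
    have h0 : 0 ≤ Real.log (⌊bigP D⌋₊ : ℝ) := Real.log_nonneg (by exact_mod_cast (by omega : 1 ≤ ⌊bigP D⌋₊))
    calc Real.log (⌊bigP D⌋₊ : ℝ) ^ 4 ≤ (ell D ^ 9) ^ 4 := pow_le_pow_left₀ h0 hlogP 4
      _ = ell D ^ 36 := by ring
  have hlog5 : Real.log (M : ℝ) ^ 5 ≤ c ^ 5 * ell D ^ 10 := by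
    have h0 : 0 ≤ Real.log (M : ℝ) := Real.log_nonneg (by exact_mod_cast (by omega : 1 ≤ M))
    calc Real.log (M : ℝ) ^ 5 ≤ (c * ell D ^ 2) ^ 5 := pow_le_pow_left₀ h0 hlogM 5
      _ = c ^ 5 * ell D ^ 10 := by ring
  have hlogs : Real.log (⌊bigP D⌋₊ : ℝ) ^ 4 * Real.log (M : ℝ) ^ 5 ≤ ell D ^ 36 * (c ^ 5 * ell D ^ 10) :=
    mul_le_mul hlog4 hlog5 (by positivity) (by positivity)
  have hmc := (majorantConst_pos 9 6).le
  have hℓ55 : 1 ≤ ell D ^ 55 := one_le_pow₀ hL1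
  calc _ = ∑ x ∈ finsetOf (PsiOne χ), ∑ ρ ∈ finsetOf (zeroSet D x),
          ‖x.ψ.LFunction (ρ + beta1 c' D) / deriv x.ψ.LFunction ρ‖ *
            ‖∑ k ∈ Icc 1 ⌊bigP D⌋₊, seqConv u' v' k * x.ψ (k : ZMod x.p) * (k : ℂ) ^ (-ρ)‖ ^ 2 *
              ‖omegaW D ρ‖ := by
        refine Finset.sum_congr rfl fun x _ => Finset.sum_congr rfl fun ρ _ => ?_
        rw [hprod x ρ]
    _ ≤ C * frakP D * ell D ^ 9 * (∑ k ∈ Icc 1 ⌊bigP D⌋₊, ‖seqConv u' v' k‖ ^ 2 / k) + frakP D := h1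
    _ ≤ C * frakP D * ell D ^ 9 *
          (βc ^ 2 * (majorantConst 9 6 * (ell D ^ 36 * (c ^ 5 * ell D ^ 10)))) + frakP D * ell D ^ 55 := by
        refine add_le_add (mul_le_mul_of_nonneg_left (hcoef.trans ?_) (by positivity)) ?_
        · exact mul_le_mul_of_nonneg_left (mul_le_mul_of_nonneg_left hlogs hmc) (sq_nonneg _)
        · calc frakP D = frakP D * 1 := (mul_one _).symm
            _ ≤ frakP D * ell D ^ 55 := mul_le_mul_of_nonneg_left hℓ55 hP
    _ = _ := by ring

/-- **Z-POLY (`N·B`): `Q(N(·+β)B) ≤ C·𝔓·𝓛⁵⁵`** for `0 ≤ c′`, `Prop22 c′`, every `β` with `Re β = 0`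
(length `2T²·PT⁻⁷ ≤ P`; coefficient mean `≪ βc²(log P)⁴(log 2T²)⁵ ≪ 𝓛⁴⁶`, `× 𝓛⁹`).
[cite: Zhang2022LandauSiegel, §13 p.75; §6 Lemma 6.1; §15 (15.2); §3 Lemma 3.3 (i)] -/
theorem zeroSum_Nchar_Bpoly_sq_le_of_prop22 {c' : ℝ} (hc' : 0 ≤ c') (h22 : Prop22 c') :
    ∃ C : ℝ, 0 ≤ C ∧ ForAllLarge fun D _ χ => ∀ β : ℂ, β.re = 0 →
      ∑ x ∈ finsetOf (PsiOne χ), ∑ ρ ∈ finsetOf (zeroSet D x),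
          ‖x.ψ.LFunction (ρ + beta1 c' D) / deriv x.ψ.LFunction ρ‖ *
            ‖Nchar D (psiFn x) (ρ + β) * Bpoly χ x ρ‖ ^ 2 * ‖omegaW D ρ‖ ≤ C * frakP D * ell D ^ 55 := by
  set βc : ℝ := (1 + ‖iota2‖) * (‖iota3‖ + ‖iota4‖) with hβc
  obtain ⟨C, hC, D₀, hcore⟩ := zeroSum_core_of_prop22 hc' h22 βc (by positivity) 3
  have hmc0 : 0 < majorantConst 9 6 := majorantConst_pos _ _
  refine ⟨C * (βc ^ 2 * majorantConst 9 6 * 3 ^ 5) + 1, by positivity, D₀, fun D _ χ hD hq hp β hβ => ?_⟩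
  obtain ⟨hL, hmain⟩ := hcore D χ hD hq hp
  obtain ⟨⟨hM2, -⟩, ⟨hlogM, -, -⟩, ⟨hlen, -, -⟩, ⟨hM1, -, -⟩⟩ := lengths_of_four_le_ell hL
  have hℓ : 0 < ell D := by linarith
  have h := zeroSum_short_Bpoly_le χ hC hL hmain hβ (g := fun n => (gstar D (bigT D ^ 2 / n) : ℂ))
    (fun n => norm_gstar_le_one hℓ _) hM2 hlen hM1 hlogM
  simpa only [Nchar_shift_eq_dirPoly] using h

/-- **Z-POLY (`D_{T³}·B`): `Q(D_{T³}(·+β)B) ≤ C·𝔓·𝓛⁵⁵`** for `0 ≤ c′`, `Prop22 c′`, every `β` with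
`Re β = 0` (the `E₁`-polynomial at `ρ + β_j + iv`: `β := β_j + iv`, uniform in `v`; length `T³·PT⁻⁷ ≤ P`).
[cite: Zhang2022LandauSiegel, §13 p.75; §6 Lemma 6.1; §15 (15.2); §3 Lemma 3.3 (i)] -/
theorem zeroSum_E1poly_Bpoly_sq_le_of_prop22 {c' : ℝ} (hc' : 0 ≤ c') (h22 : Prop22 c') :
    ∃ C : ℝ, 0 ≤ C ∧ ForAllLarge fun D _ χ => ∀ β : ℂ, β.re = 0 →
      ∑ x ∈ finsetOf (PsiOne χ), ∑ ρ ∈ finsetOf (zeroSet D x),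
          ‖x.ψ.LFunction (ρ + beta1 c' D) / deriv x.ψ.LFunction ρ‖ *
            ‖(∑ n ∈ Finset.Ico 1 ⌈bigT D ^ 3⌉₊, x.ψ (n : ZMod x.p) * (n : ℂ) ^ (-(ρ + β))) *
              Bpoly χ x ρ‖ ^ 2 * ‖omegaW D ρ‖ ≤ C * frakP D * ell D ^ 55 := by
  set βc : ℝ := (1 + ‖iota2‖) * (‖iota3‖ + ‖iota4‖) with hβc
  obtain ⟨C, hC, D₀, hcore⟩ := zeroSum_core_of_prop22 hc' h22 βc (by positivity) 3
  have hmc0 : 0 < majorantConst 9 6 := majorantConst_pos _ _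
  refine ⟨C * (βc ^ 2 * majorantConst 9 6 * 4 ^ 5) + 1, by positivity, D₀, fun D _ χ hD hq hp β hβ => ?_⟩
  obtain ⟨hL, hmain⟩ := hcore D χ hD hq hp
  obtain ⟨⟨-, hM2⟩, ⟨-, hlogM, -⟩, ⟨-, hlen, -⟩, ⟨-, hM1, -⟩⟩ := lengths_of_four_le_ell hL
  have h := zeroSum_short_Bpoly_le χ hC hL hmain hβ (g := fun _ => (1 : ℂ)) (fun n => by simp)
    hM2 hlen hM1 hlogM
  simpa only [E1poly_shift_eq_dirPoly] using h

/-- **Z-POLY (`N`): `Q(N(·+β)) ≤ C·𝔓·𝓛¹¹`** for `0 ≤ c′`, `Prop22 c′`, every `β` with `Re β = 0`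
(length `2T² ≤ P`, bounded coefficients: `Σ 1/n ≤ 1 + log 2T² ≪ 𝓛²`, `× 𝓛⁹`).
[cite: Zhang2022LandauSiegel, §13 p.75; §6 Lemma 6.1; §3 Lemma 3.3 (i)] -/
theorem zeroSum_Nchar_sq_le_of_prop22 {c' : ℝ} (hc' : 0 ≤ c') (h22 : Prop22 c') :
    ∃ C : ℝ, 0 ≤ C ∧ ForAllLarge fun D _ χ => ∀ β : ℂ, β.re = 0 →
      ∑ x ∈ finsetOf (PsiOne χ), ∑ ρ ∈ finsetOf (zeroSet D x),
          ‖x.ψ.LFunction (ρ + beta1 c' D) / deriv x.ψ.LFunction ρ‖ *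
            ‖Nchar D (psiFn x) (ρ + β)‖ ^ 2 * ‖omegaW D ρ‖ ≤ C * frakP D * ell D ^ 11 := by
  obtain ⟨C, hC, D₀, hcore⟩ := zeroSum_core_of_prop22 hc' h22 1 zero_le_one 0
  refine ⟨C * 5 + 1, by positivity, D₀, fun D _ χ hD hq hp β hβ => ?_⟩
  obtain ⟨hL, hmain⟩ := hcore D χ hD hq hp
  have hL1 : 1 ≤ ell D := by linarith
  have hℓ : 0 < ell D := by linarith
  obtain ⟨⟨hM2, -⟩, ⟨hlogM, -, -⟩, -, ⟨hM1, -, -⟩⟩ := lengths_of_four_le_ell hL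
  set M := ⌈2 * bigT D ^ 2⌉₊ with hM
  have hP : 0 ≤ frakP D := by
    rw [frakP_eq_sum_primeWindow]; exact Finset.sum_nonneg fun p _ => Nat.cast_nonneg p
  set g : ℕ → ℂ := fun n => (gstar D (bigT D ^ 2 / n) : ℂ) with hg'
  have hg : ∀ n, ‖g n‖ ≤ 1 := fun n => norm_gstar_le_one hℓ _
  set u' : ℕ → ℂ := fun n => if n < M then g n * (n : ℂ) ^ (-β) else 0 with hu'
  have hpoly : ∀ (x : Chr D) (ρ : ℂ), Nchar D (psiFn x) (ρ + β) =
      ∑ n ∈ Icc 1 ⌊bigP D⌋₊, u' n * x.ψ (n : ZMod x.p) * (n : ℂ) ^ (-ρ) := by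
    intro x ρ
    rw [Nchar_shift_eq_dirPoly x ρ β]
    exact sum_Ico_eq_sum_Icc_trunc hM1 _ _ ρ
  have hu1 : ∀ n, ‖u' n‖ ≤ 1 := by
    intro n
    simp only [hu']
    split_ifs with h
    · rcases Nat.eq_zero_or_pos n with rfl | hn
      · have : (0 : ℂ) ^ (-β) = 0 ∨ (0 : ℂ) ^ (-β) = 1 := by
          by_cases hb : -β = 0
          · right; rw [hb, Complex.cpow_zero]
          · left; exact Complex.zero_cpow hb
        rcases this with h0 | h0 <;> rw [Nat.cast_zero, h0]
        · simp
        · rw [mul_one]; exact hg 0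
      · rw [norm_mul, norm_natCast_cpow_neg_of_re_zero hn.ne' hβ, mul_one]; exact hg n
    · simp
  have hsup : ∀ n, ‖u' n‖ ≤ 1 * (bigP D + 1) ^ 0 := fun n => by rw [pow_zero, mul_one]; exact hu1 n
  have h1 := hmain u' hsup
  -- the diagonal lives on `n ≤ M − 1`
  have hsupp : ∑ n ∈ Icc 1 ⌊bigP D⌋₊, ‖u' n‖ ^ 2 / n = ∑ n ∈ Icc 1 (M - 1), ‖u' n‖ ^ 2 / n := by
    symm
    refine Finset.sum_subset (fun n hn => ?_) (fun n hn hn' => ?_)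
    · rw [Finset.mem_Icc] at hn ⊢; exact ⟨hn.1, hn.2.trans hM1⟩
    · rw [Finset.mem_Icc] at hn
      rw [Finset.mem_Icc, not_and, not_le] at hn'
      have : ¬ n < M := by have := hn' hn.1; omega
      simp [hu', this]
  have hcoef := sum_norm_sq_div_le_one_add_log hu1 (M - 1)
  have hlg : 1 + Real.log ((M - 1 : ℕ) : ℝ) ≤ 5 * ell D ^ 2 := by
    have h1' : Real.log ((M - 1 : ℕ) : ℝ) ≤ Real.log (M : ℝ) :=
      Real.log_le_log (by exact_mod_cast (by omega : 0 < M - 1)) (by exact_mod_cast Nat.sub_le M 1)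
    have h2 : (1 : ℝ) ≤ ell D ^ 2 := by nlinarith
    nlinarith [pow_nonneg hℓ.le 2]
  have hℓ11 : 1 ≤ ell D ^ 11 := one_le_pow₀ hL1
  calc _ = ∑ x ∈ finsetOf (PsiOne χ), ∑ ρ ∈ finsetOf (zeroSet D x),
          ‖x.ψ.LFunction (ρ + beta1 c' D) / deriv x.ψ.LFunction ρ‖ *
            ‖∑ n ∈ Icc 1 ⌊bigP D⌋₊, u' n * x.ψ (n : ZMod x.p) * (n : ℂ) ^ (-ρ)‖ ^ 2 * ‖omegaW D ρ‖ := by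
        refine Finset.sum_congr rfl fun x _ => Finset.sum_congr rfl fun ρ _ => ?_
        rw [hpoly x ρ]
    _ ≤ C * frakP D * ell D ^ 9 * (∑ n ∈ Icc 1 ⌊bigP D⌋₊, ‖u' n‖ ^ 2 / n) + frakP D := h1
    _ ≤ C * frakP D * ell D ^ 9 * (5 * ell D ^ 2) + frakP D * ell D ^ 11 := by
        refine add_le_add (mul_le_mul_of_nonneg_left ?_ (by positivity)) ?_
        · rw [hsupp]; exact hcoef.trans hlg
        · calc frakP D = frakP D * 1 := (mul_one _).symm
            _ ≤ frakP D * ell D ^ 11 := mul_le_mul_of_nonneg_left hℓ11 hP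
    _ = (C * 5 + 1) * frakP D * ell D ^ 11 := by ring

/-- **Z-POLY (`N·N`): `Q(N(·+β)N(·+β′)) ≤ C·𝔓·𝓛¹⁷`** for `0 ≤ c′`, `Prop22 c′`, all `β, β′` with
`Re β = Re β′ = 0` (length `4T⁴ ≤ P`; coefficient mean `≤ majorantConst 4 2·(log 2T²)⁴ ≪ 𝓛⁸`, `× 𝓛⁹`).
[cite: Zhang2022LandauSiegel, §13 p.75; §6 Lemma 6.1; §3 Lemma 3.3 (i)] -/
theorem zeroSum_Nchar_Nchar_sq_le_of_prop22 {c' : ℝ} (hc' : 0 ≤ c') (h22 : Prop22 c') :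
    ∃ C : ℝ, 0 ≤ C ∧ ForAllLarge fun D _ χ => ∀ β β' : ℂ, β.re = 0 → β'.re = 0 →
      ∑ x ∈ finsetOf (PsiOne χ), ∑ ρ ∈ finsetOf (zeroSet D x),
          ‖x.ψ.LFunction (ρ + beta1 c' D) / deriv x.ψ.LFunction ρ‖ *
            ‖Nchar D (psiFn x) (ρ + β) * Nchar D (psiFn x) (ρ + β')‖ ^ 2 * ‖omegaW D ρ‖ ≤
        C * frakP D * ell D ^ 17 := by
  obtain ⟨C, hC, D₀, hcore⟩ := zeroSum_core_of_prop22 hc' h22 1 zero_le_one 2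
  have hmc0 : 0 < majorantConst 4 2 := majorantConst_pos _ _
  refine ⟨C * (majorantConst 4 2 * 3 ^ 4) + 1, by positivity, D₀, fun D _ χ hD hq hp β β' hβ hβ' => ?_⟩
  obtain ⟨hL, hmain⟩ := hcore D χ hD hq hp
  have hL1 : 1 ≤ ell D := by linarith
  have hℓ : 0 < ell D := by linarith
  obtain ⟨⟨hM2, -⟩, ⟨hlogM, -, -⟩, ⟨-, -, hlen⟩, ⟨hM1, -, -⟩⟩ := lengths_of_four_le_ell hL
  obtain ⟨-, -, -, hP2⟩ := sizes_of_four_le_ell hL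
  set M := ⌈2 * bigT D ^ 2⌉₊ with hM
  have hP : 0 ≤ frakP D := by
    rw [frakP_eq_sum_primeWindow]; exact Finset.sum_nonneg fun p _ => Nat.cast_nonneg p
  have hP0 : 0 < bigP D := Real.exp_pos _
  set g : ℕ → ℂ := fun n => (gstar D (bigT D ^ 2 / n) : ℂ) with hg'
  have hg : ∀ n, ‖g n‖ ≤ 1 := fun n => norm_gstar_le_one hℓ _
  set u' : ℕ → ℂ := fun n => if n < M then g n * (n : ℂ) ^ (-β) else 0 with hu'
  set v' : ℕ → ℂ := fun n => if n < M then g n * (n : ℂ) ^ (-β') else 0 with hv'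
  have hprod : ∀ (x : Chr D) (ρ : ℂ), Nchar D (psiFn x) (ρ + β) * Nchar D (psiFn x) (ρ + β') =
      ∑ k ∈ Icc 1 ⌊bigP D⌋₊, seqConv u' v' k * x.ψ (k : ZMod x.p) * (k : ℂ) ^ (-ρ) := by
    intro x ρ
    rw [Nchar_shift_eq_dirPoly x ρ β, Nchar_shift_eq_dirPoly x ρ β']
    exact dirPoly_mul_dirPoly_eq M M ⌊bigP D⌋₊ hlen _ _ _ (psi_natCast_mul x).1 ρ
  have hunit : ∀ {γ : ℂ}, γ.re = 0 → ∀ n, ‖(if n < M then g n * (n : ℂ) ^ (-γ) else 0)‖ ≤ 1 := by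
    intro γ hγ n
    split_ifs with h
    · rcases Nat.eq_zero_or_pos n with rfl | hn
      · have : (0 : ℂ) ^ (-γ) = 0 ∨ (0 : ℂ) ^ (-γ) = 1 := by
          by_cases hb : -γ = 0
          · right; rw [hb, Complex.cpow_zero]
          · left; exact Complex.zero_cpow hb
        rcases this with h0 | h0 <;> rw [Nat.cast_zero, h0]
        · simp
        · rw [mul_one]; exact hg 0
      · rw [norm_mul, norm_natCast_cpow_neg_of_re_zero hn.ne' hγ, mul_one]; exact hg n
    · simp
  have hu1 : ∀ n, ‖u' n‖ ≤ 1 := hunit hβ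
  have hv1 : ∀ n, ‖v' n‖ ≤ 1 := hunit hβ'
  have hMle : (M : ℝ) ≤ bigP D + 1 := by
    have h1 : ((M - 1 : ℕ) : ℝ) ≤ ⌊bigP D⌋₊ := by exact_mod_cast hM1
    have h2 : (⌊bigP D⌋₊ : ℝ) ≤ bigP D := Nat.floor_le hP0.le
    have h3 : (M : ℝ) ≤ ((M - 1 : ℕ) : ℝ) + 1 := by
      rcases Nat.eq_zero_or_pos M with h | h
      · rw [h]; simp
      · rw [Nat.cast_sub h]; simp
    linarith
  have hsup : ∀ k, ‖seqConv u' v' k‖ ≤ 1 * (bigP D + 1) ^ 2 := by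
    intro k
    have h := norm_seqConv_trunc_le (u := u') (v := v') zero_le_one (M := M) (N := M)
      hu1 (fun n hn => by simp only [hu']; rw [if_neg (not_lt.mpr hn)]) (fun n _ => hv1 n)
      (fun n hn => by simp only [hv']; rw [if_neg (not_lt.mpr hn)]) k
    refine h.trans ?_
    calc (M : ℝ) * M * 1 * 1 = M * M := by ring
      _ ≤ (bigP D + 1) * (bigP D + 1) := by gcongr
      _ = 1 * (bigP D + 1) ^ 2 := by ring
  have h1 := hmain (seqConv u' v') hsup
  have hu : Dom u' 1 (smoothIndLE M) := dom_trunc_unimodular hg hβ M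
  have hv : Dom v' 1 (smoothIndLE M) := dom_trunc_unimodular hg hβ' M
  have hcoef := sum_norm_seqConv_short_short_sq_div_le hu hv hM2 hP2
  have hlog4 : Real.log (M : ℝ) ^ 4 ≤ 3 ^ 4 * ell D ^ 8 := by
    have h0 : 0 ≤ Real.log (M : ℝ) := Real.log_nonneg (by exact_mod_cast (by omega : 1 ≤ M))
    calc Real.log (M : ℝ) ^ 4 ≤ (3 * ell D ^ 2) ^ 4 := pow_le_pow_left₀ h0 hlogM 4
      _ = 3 ^ 4 * ell D ^ 8 := by ring
  have hmc := (majorantConst_pos 4 2).le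
  have hℓ17 : 1 ≤ ell D ^ 17 := one_le_pow₀ hL1
  calc _ = ∑ x ∈ finsetOf (PsiOne χ), ∑ ρ ∈ finsetOf (zeroSet D x),
          ‖x.ψ.LFunction (ρ + beta1 c' D) / deriv x.ψ.LFunction ρ‖ *
            ‖∑ k ∈ Icc 1 ⌊bigP D⌋₊, seqConv u' v' k * x.ψ (k : ZMod x.p) * (k : ℂ) ^ (-ρ)‖ ^ 2 *
              ‖omegaW D ρ‖ := by
        refine Finset.sum_congr rfl fun x _ => Finset.sum_congr rfl fun ρ _ => ?_
        rw [hprod x ρ]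
    _ ≤ C * frakP D * ell D ^ 9 * (∑ k ∈ Icc 1 ⌊bigP D⌋₊, ‖seqConv u' v' k‖ ^ 2 / k) + frakP D := h1
    _ ≤ C * frakP D * ell D ^ 9 * (majorantConst 4 2 * (3 ^ 4 * ell D ^ 8)) + frakP D * ell D ^ 17 := by
        refine add_le_add (mul_le_mul_of_nonneg_left (hcoef.trans ?_) (by positivity)) ?_
        · exact mul_le_mul_of_nonneg_left hlog4 hmc
        · calc frakP D = frakP D * 1 := (mul_one _).symm
            _ ≤ frakP D * ell D ^ 17 := mul_le_mul_of_nonneg_left hℓ17 hP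
    _ = (C * (majorantConst 4 2 * 3 ^ 4) + 1) * frakP D * ell D ^ 17 := by ring

end Literature.NumberTheory.LFunctions.Zhang2022.Typed.Section13
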